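import Summits.Parity.GeneralizedHardyLittlewood.Theorems.LeeYangFibresAbsoluteUpgradeClipCellsAux
import HarnessLib

/-!
# Route `LeeYangFibres`, crux `AbsoluteUpgrade` (stmt-Parity-14116), line `nlc-cells-absolute-clip`:
# the clipping budget at one scale (helper file for the registered stub `stub_clipCells`)

Pure real-variable bookkeeping: given, at one scale `N` (with `ℓ = log N`) and one roughness `u`, cells
`C_j ≥ 0`, densities `a_m ≥ 0`, a mass `M`, amplitudes `θ` and the instantiated hypotheses of the line
(cell law with accuracy `ε_law N/ℓ^t`, corner NLC with slack `η (M/N)(N/ℓ^t)²`, the signed marginals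
`≤ C_s E M (u/ℓ)^t + N/ℓ^{t+1}`, the parity balance `|ã| ≤ C₁ E₁ u/ℓ + 1/ℓ²`, the anatomy
`a_m ≥ c_an/ℓ` on the corner, `a_1 ≤ 2/ℓ`, `â ≥ c_an u/ℓ`, and Walsh clipping with constants `c₀, C_W`),
the prime-corner cell is its model up to `ε N/ℓ^t`:

* `clipCells_lowMass` (registered sub-goal) — mass `M ≤ η₀ N`: the law alone (`|Θ_θ(𝟙)| ≤ 2^{t+1}`);
* `highMass_bound` — mass `M ≥ η₀ N`: singles `τ` from the marginal Walsh identity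
  (`abs_theta_singleton_le`), clipping of the normalised corner cells (`walsh_corner_clip`), and the budget
  `C_W (δ + η_n + τ) M a_1^t ≤ (ε/2) N/ℓ^t`, in which `M` cancels except against the decaying factors
  `E = e^{-c u}` (hypotheses `E·B ≤ D`, where `M ≤ B N`) — the twelve smallness conditions are hypotheses,
  discharged by the parameter choice in `Theorems/LeeYangFibresAbsoluteUpgradeClipCells.lean`.
-/

noncomputable section

open scoped BigOperators
open Finset Filter

namespace Summit.Parity.GeneralizedHardyLittlewood.Theorems.AbsoluteUpgrade

open Literature.NumberTheory.Sieve
open Summit.Parity.GeneralizedHardyLittlewood.Cruxes.AbsoluteUpgrade.NlcCellsAbsoluteClip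

variable {t : ℕ}

/-! ## The prime corner value of the Walsh form and the law-only bound -/

/-- `|Θ_θ(𝟙)| = |Σ_S θ_S| ≤ 2^{t+1}` when `|θ_S| ≤ 2`. [folklore] -/
theorem abs_walshForm_one_le (θ : Finset (Fin t) → ℝ) (hθ2 : ∀ S, |θ S| ≤ 2) :
    |walshForm θ (fun _ => 1)| ≤ 2 ^ (t + 1) := by
  unfold walshForm
  calc |∑ S : Finset (Fin t), θ S * ∏ i ∈ S, (-1 : ℝ) ^ (1 + 1)|
      ≤ ∑ S : Finset (Fin t), |θ S * ∏ i ∈ S, (-1 : ℝ) ^ (1 + 1)| := abs_sum_le_sum_abs _ _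
    _ ≤ ∑ _S : Finset (Fin t), (2 : ℝ) := sum_le_sum fun S _ => by
        rw [show ∏ i ∈ S, (-1 : ℝ) ^ (1 + 1) = 1 from prod_eq_one fun i _ => by norm_num, mul_one]
        exact hθ2 S
    _ = 2 ^ (t + 1) := by
        rw [sum_const, card_univ, Fintype.card_finset, Fintype.card_fin, nsmul_eq_mul, pow_succ]
        push_cast
        ring

/-- From the Walsh value to the cell: `|C − M m| ≤ |C − Θ M m| + |Θ − 1| M m` (`M m ≥ 0`). [folklore] -/
theorem abs_sub_model_le (C Θ Mm : ℝ) (hMm : 0 ≤ Mm) :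
    |C - Mm| ≤ |C - Θ * Mm| + |Θ - 1| * Mm := by
  have h : C - Mm = (C - Θ * Mm) + (Θ - 1) * Mm := by ring
  rw [h]
  exact (abs_add_le _ _).trans (by rw [abs_mul, abs_of_nonneg hMm])

/-- **Low mass: the law alone** (registered sub-goal `clipCells_lowMass`, stated verbatim as registered).
If `|C_𝟙 − Θ_θ(𝟙) M m_𝟙| ≤ e₁`, `|θ_S| ≤ 2`, `0 ≤ M m_𝟙`, then `|C_𝟙 − M m_𝟙| ≤ e₁ + (2^{t+1} + 1) M m_𝟙`.
[folklore] -/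
theorem clipCells_lowMass : ∀ {t : ℕ} (θ : Finset (Fin t) → ℝ), (∀ S, |θ S| ≤ 2) → ∀ {C Mm e₁ : ℝ}, 0 ≤ Mm → |C - walshForm θ (fun _ => 1) * Mm| ≤ e₁ → |C - Mm| ≤ e₁ + (2 ^ (t + 1) + 1) * Mm := by
  intro t θ hθ2 C Mm e₁ hMm hlaw
  have h1 : |walshForm θ (fun _ => 1) - 1| ≤ 2 ^ (t + 1) + 1 := by
    have h := abs_sub (walshForm θ (fun _ => 1)) 1
    rw [abs_one] at h
    linarith [abs_walshForm_one_le θ hθ2]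
  calc |C - Mm| ≤ |C - walshForm θ (fun _ => 1) * Mm| + |walshForm θ (fun _ => 1) - 1| * Mm :=
        abs_sub_model_le C _ Mm hMm
    _ ≤ e₁ + (2 ^ (t + 1) + 1) * Mm := add_le_add hlaw (mul_le_mul_of_nonneg_right h1 hMm)

/-! ## High mass: singles, clipping, budget -/

/-- Corner indices lie in `[1,u]^t` for `u ≥ 3`. [folklore] -/
theorem isCorner_mem_piFinset {u : ℕ} (hu : 3 ≤ u) {j : Fin t → ℕ} (hj : IsCorner j) :
    j ∈ Fintype.piFinset (fun _ : Fin t => Icc 1 u) :=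
  Fintype.mem_piFinset.mpr fun i => mem_Icc.mpr ⟨(hj i).1, (hj i).2.trans hu⟩

/-- **High mass: the clipping budget at one scale.**  With `ℓ = log N ≥ 1`, mass `η₀ N ≤ M ≤ B N`,
cells `C_j ≥ 0` obeying the law (accuracy `ε_law N/ℓ^t` on `[1,u]^t`) and corner NLC (slack
`η (M/N)(N/ℓ^t)²`), signed marginals `≤ C_s E M (u/ℓ)^t + N/ℓ^{t+1}`, parity balance
`|ã| ≤ C₁ E₁ u/ℓ + 1/ℓ²`, anatomy `a_m ≥ c_an/ℓ` (`m ≤ 3`), `a_1 ≤ 2/ℓ`, `â ≥ c_an u/ℓ`, Walsh clipping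
with constants `c₀, C_W`, decay `E B, E₁ B ≤ D`, `E, E₁ ≤ D'`, and the twelve smallness conditions
(`ε'`-budget `s₁…s₆`, `c₀`-budget `r₁…r₆`), one has `|C_𝟙 − M a_1^t| ≤ ε N/ℓ^t`.  The singles are
`τ ≤ C_s E/c_an^t + N/(M c_an^t u^t ℓ) + ε_law N/(M c_an^t) + 2^{t+1}(C₁ E₁/c_an + 1/(c_an u ℓ))`
(marginal Walsh identity), clipping gives `|Θ(𝟙) − 1| ≤ C_W(δ + η_n + τ)` for the normalised corner
cells, and in `C_W(δ + η_n + τ) M a_1^t` the mass `M` cancels except against `E, E₁` and `1/(uℓ)`.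
[folklore] -/
theorem highMass_bound {u : ℕ} (hu : 4 ≤ u) {c₀ C_W : ℝ} (hCW : 0 ≤ C_W)
    (hW : ∀ (θ : Finset (Fin t) → ℝ) (c : (Fin t → ℕ) → ℝ) (δ η τ : ℝ),
      0 ≤ δ → 0 ≤ η → 0 ≤ τ → δ + η + τ ≤ c₀ →
      θ ∅ = 1 → (∀ S, |θ S| ≤ 2) → (∀ i : Fin t, |θ {i}| ≤ τ) →
      (∀ j, IsCorner j → 0 ≤ c j ∧ |c j - walshForm θ j| ≤ δ) →
      (∀ j j', IsCorner j → IsCorner j' → c (j ⊔ j') * c (j ⊓ j') ≤ c j * c j' + η) →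
        |walshForm θ (fun _ => 1) - 1| ≤ C_W * (δ + η + τ))
    (θ : Finset (Fin t) → ℝ) (hθ0 : θ ∅ = 1) (hθ2 : ∀ S, |θ S| ≤ 2)
    (C : (Fin t → ℕ) → ℝ) (hC : ∀ j, 0 ≤ C j) (a : ℕ → ℝ) (ha0 : ∀ m, 0 ≤ a m)
    {N ℓ M B η₀ c_an ε ε' ε_law η C_s C₁ E E₁ D D' : ℝ}
    (hN : 0 < N) (hℓ : 1 ≤ ℓ) (hη₀ : 0 < η₀) (hM : η₀ * N ≤ M) (hMB : M ≤ B * N)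
    (hc_an : 0 < c_an) (hε_law : 0 ≤ ε_law) (hη : 0 ≤ η) (hC_s : 0 ≤ C_s) (hC₁ : 0 ≤ C₁)
    (hE : 0 ≤ E) (hE₁ : 0 ≤ E₁)
    (hED : E * B ≤ D) (hE₁D : E₁ * B ≤ D) (hED' : E ≤ D') (hE₁D' : E₁ ≤ D')
    (hcorner : ∀ m ∈ ({1, 2, 3} : Finset ℕ), c_an / ℓ ≤ a m) (ha1 : a 1 ≤ 2 / ℓ)
    (hsum : c_an * u / ℓ ≤ ∑ m ∈ Icc 1 u, a m)
    (hlaw : ∀ j ∈ Fintype.piFinset (fun _ : Fin t => Icc 1 u),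
      |C j - walshForm θ j * (M * ∏ k, a (j k))| ≤ ε_law * N / ℓ ^ t)
    (hnlc : ∀ j j', IsCorner j → IsCorner j' →
      C (j ⊔ j') * C (j ⊓ j') ≤ C j * C j' + η * (M / N) * (N / ℓ ^ t) ^ 2)
    (hsing : ∀ i : Fin t, |∑ j ∈ Fintype.piFinset (fun _ : Fin t => Icc 1 u), (-1 : ℝ) ^ (j i) * C j| ≤
      C_s * E * M * ((u : ℝ) / ℓ) ^ t + N / ℓ ^ (t + 1))
    (hbal : |∑ m ∈ Icc 1 u, (-1 : ℝ) ^ m * a m| ≤ C₁ * E₁ * ((u : ℝ) / ℓ) + 1 / ℓ ^ 2)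
    (s₁ : 2 * ε_law / c_an ^ t ≤ ε') (s₂ : η / c_an ^ (2 * t) ≤ ε') (s₃ : C_s * D / c_an ^ t ≤ ε')
    (s₄ : 1 / (c_an ^ t * ℓ) ≤ ε') (s₅ : 2 ^ (t + 1) * C₁ * D / c_an ≤ ε')
    (s₆ : 2 ^ (t + 1) * B / (4 * c_an * ℓ) ≤ ε')
    (hε' : 6 * ε' * (C_W * 2 ^ t) ≤ ε / 2) (hε_law2 : ε_law ≤ ε / 2)
    (r₁ : ε_law / (η₀ * c_an ^ t) ≤ c₀ / 12) (r₂ : η / (η₀ * c_an ^ (2 * t)) ≤ c₀ / 6)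
    (r₃ : C_s * D' / c_an ^ t ≤ c₀ / 6) (r₄ : 1 / (η₀ * c_an ^ t * ℓ) ≤ c₀ / 6)
    (r₅ : 2 ^ (t + 1) * C₁ * D' / c_an ≤ c₀ / 6) (r₆ : 2 ^ (t + 1) / (4 * c_an * ℓ) ≤ c₀ / 6) :
    |C (fun _ => 1) - M * a 1 ^ t| ≤ ε * N / ℓ ^ t := by
  -- positivity bookkeeping
  have hℓ0 : 0 < ℓ := by linarith
  have hM0 : 0 < M := lt_of_lt_of_le (by positivity) hM
  have hu0 : (0 : ℝ) < u := by exact_mod_cast (show 0 < u by omega)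
  have hu1 : (1 : ℝ) ≤ u := by exact_mod_cast (show 1 ≤ u by omega)
  have hu4 : (4 : ℝ) ≤ u := by exact_mod_cast hu
  have hu' : 1 / (u : ℝ) ^ t ≤ 1 := by
    rw [div_le_one (by positivity)]; exact one_le_pow₀ hu1
  have hct : 0 < c_an ^ t := pow_pos hc_an t
  have hε'0 : 0 ≤ ε' := le_trans (by positivity) s₄
  have hNM : N / M ≤ 1 / η₀ := by
    rw [div_le_div_iff₀ hM0 hη₀, one_mul, mul_comm]; exact hM
  set A := ∑ m ∈ Icc 1 u, a m with hAdef
  have hA : c_an * u / ℓ ≤ A := hsum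
  have hA0 : 0 < A := lt_of_lt_of_le (by positivity) hA
  -- the law error, the NLC slack, the singles bound
  set e₁ : ℝ := ε_law * N / ℓ ^ t with he₁
  set e₂ : ℝ := η * (M / N) * (N / ℓ ^ t) ^ 2 with he₂
  set τ : ℝ := C_s * E / c_an ^ t + N / (M * c_an ^ t * u ^ t * ℓ) + ε_law * N / (M * c_an ^ t) +
    2 ^ (t + 1) * (C₁ * E₁ / c_an + 1 / (c_an * u * ℓ)) with hτdef
  have he₁0 : 0 ≤ e₁ := by rw [he₁]; positivity
  have he₂0 : 0 ≤ e₂ := by rw [he₂]; positivity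
  have hτ0 : 0 ≤ τ := by rw [hτdef]; positivity
  -- Step 1: the singles
  have hsingles : ∀ i : Fin t, |θ {i}| ≤ τ := by
    intro i
    have h := abs_theta_singleton_le θ hθ2 C hM0 a ha0 hA0 i hlaw (hsing i)
    rw [← hAdef] at h
    refine h.trans ?_
    have hX0 : 0 ≤ C_s * E * M * ((u : ℝ) / ℓ) ^ t + N / ℓ ^ (t + 1) + (u : ℝ) ^ t * e₁ := by positivity
    have hden : 0 < M * (c_an * u / ℓ) ^ t := by positivity
    have h1 : (C_s * E * M * ((u : ℝ) / ℓ) ^ t + N / ℓ ^ (t + 1) + (u : ℝ) ^ t * e₁) / (M * A ^ t) ≤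
        (C_s * E * M * ((u : ℝ) / ℓ) ^ t + N / ℓ ^ (t + 1) + (u : ℝ) ^ t * e₁) / (M * (c_an * u / ℓ) ^ t) := by
      apply div_le_div_of_nonneg_left hX0 hden
      exact mul_le_mul_of_nonneg_left (pow_le_pow_left₀ (by positivity) hA t) hM0.le
    have h2 : (C_s * E * M * ((u : ℝ) / ℓ) ^ t + N / ℓ ^ (t + 1) + (u : ℝ) ^ t * e₁) / (M * (c_an * u / ℓ) ^ t) =
        C_s * E / c_an ^ t + N / (M * c_an ^ t * u ^ t * ℓ) + ε_law * N / (M * c_an ^ t) := by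
      rw [he₁]
      simp only [div_pow, mul_pow]
      field_simp
      ring
    have h3 : 2 ^ (t + 1) * |∑ m ∈ Icc 1 u, (-1 : ℝ) ^ m * a m| / A ≤
        2 ^ (t + 1) * (C₁ * E₁ / c_an + 1 / (c_an * u * ℓ)) := by
      rw [div_le_iff₀ hA0]
      calc 2 ^ (t + 1) * |∑ m ∈ Icc 1 u, (-1 : ℝ) ^ m * a m|
          ≤ 2 ^ (t + 1) * (C₁ * E₁ * ((u : ℝ) / ℓ) + 1 / ℓ ^ 2) := by gcongr
        _ = 2 ^ (t + 1) * (C₁ * E₁ / c_an + 1 / (c_an * u * ℓ)) * (c_an * u / ℓ) := by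
            field_simp
        _ ≤ 2 ^ (t + 1) * (C₁ * E₁ / c_an + 1 / (c_an * u * ℓ)) * A := by gcongr
    rw [hτdef]
    linarith [h1, h2, h3]
  -- Step 2: clipping of the normalised corner cells
  have hlawc : ∀ j, IsCorner j → |C j - walshForm θ j * (M * ∏ i, a (j i))| ≤ e₁ :=
    fun j hj => hlaw j (isCorner_mem_piFinset (by omega) hj)
  have hδ : e₁ / (M * (c_an / ℓ) ^ t) = ε_law * N / (M * c_an ^ t) := by
    rw [he₁, div_pow]
    field_simp
  have hηn : e₂ / (M ^ 2 * (c_an / ℓ) ^ (2 * t)) = η * N / (M * c_an ^ (2 * t)) := by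
    rw [he₂, div_pow, div_pow, ← pow_mul, mul_comm t 2]
    field_simp
  -- smallness `δ + η_n + τ ≤ c₀`
  have hsmall : e₁ / (M * (c_an / ℓ) ^ t) + e₂ / (M ^ 2 * (c_an / ℓ) ^ (2 * t)) + τ ≤ c₀ := by
    rw [hδ, hηn, hτdef]
    have q1 : ε_law * N / (M * c_an ^ t) ≤ c₀ / 12 := by
      calc ε_law * N / (M * c_an ^ t) = ε_law / c_an ^ t * (N / M) := by field_simp
        _ ≤ ε_law / c_an ^ t * (1 / η₀) := mul_le_mul_of_nonneg_left hNM (by positivity)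
        _ = ε_law / (η₀ * c_an ^ t) := by field_simp
        _ ≤ c₀ / 12 := r₁
    have q2 : η * N / (M * c_an ^ (2 * t)) ≤ c₀ / 6 := by
      calc η * N / (M * c_an ^ (2 * t)) = η / c_an ^ (2 * t) * (N / M) := by field_simp
        _ ≤ η / c_an ^ (2 * t) * (1 / η₀) := mul_le_mul_of_nonneg_left hNM (by positivity)
        _ = η / (η₀ * c_an ^ (2 * t)) := by field_simp
        _ ≤ c₀ / 6 := r₂
    have q3 : C_s * E / c_an ^ t ≤ c₀ / 6 :=
      (div_le_div_of_nonneg_right (mul_le_mul_of_nonneg_left hED' hC_s) hct.le).trans r₃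
    have q4 : N / (M * c_an ^ t * u ^ t * ℓ) ≤ c₀ / 6 := by
      calc N / (M * c_an ^ t * u ^ t * ℓ) = (N / M) * (1 / (c_an ^ t * ℓ)) * (1 / u ^ t) := by
            field_simp
        _ ≤ (1 / η₀) * (1 / (c_an ^ t * ℓ)) * 1 := by gcongr
        _ = 1 / (η₀ * c_an ^ t * ℓ) := by field_simp
        _ ≤ c₀ / 6 := r₄
    have q5 : 2 ^ (t + 1) * (C₁ * E₁ / c_an) ≤ c₀ / 6 := by
      calc 2 ^ (t + 1) * (C₁ * E₁ / c_an) ≤ 2 ^ (t + 1) * (C₁ * D' / c_an) := by gcongr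
        _ = 2 ^ (t + 1) * C₁ * D' / c_an := by ring
        _ ≤ c₀ / 6 := r₅
    have q6 : 2 ^ (t + 1) * (1 / (c_an * u * ℓ)) ≤ c₀ / 6 := by
      calc 2 ^ (t + 1) * (1 / (c_an * u * ℓ)) ≤ 2 ^ (t + 1) * (1 / (c_an * 4 * ℓ)) := by gcongr
        _ = 2 ^ (t + 1) / (4 * c_an * ℓ) := by ring
        _ ≤ c₀ / 6 := r₆
    have : 2 ^ (t + 1) * (C₁ * E₁ / c_an + 1 / (c_an * u * ℓ)) =
        2 ^ (t + 1) * (C₁ * E₁ / c_an) + 2 ^ (t + 1) * (1 / (c_an * u * ℓ)) := by ring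
    linarith
  have hclip := walsh_corner_clip hW θ hθ0 hθ2 C hC hM0 (show 0 < c_an / ℓ by positivity) he₁0 he₂0 hτ0
    a hcorner hlawc hnlc hsingles hsmall
  -- Step 3: the budget
  set S : ℝ := e₁ / (M * (c_an / ℓ) ^ t) + e₂ / (M ^ 2 * (c_an / ℓ) ^ (2 * t)) + τ with hSdef
  have hS0 : 0 ≤ S := by rw [hSdef]; positivity
  have ha10 : 0 ≤ a 1 := ha0 1
  have hMm : 0 ≤ M * a 1 ^ t := by positivity
  have hone : (fun _ : Fin t => (1 : ℕ)) ∈ Fintype.piFinset (fun _ : Fin t => Icc 1 u) :=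
    Fintype.mem_piFinset.mpr fun _ => mem_Icc.mpr ⟨le_rfl, by omega⟩
  have hlaw1 : |C (fun _ => 1) - walshForm θ (fun _ => 1) * (M * a 1 ^ t)| ≤ e₁ := by
    have := hlaw _ hone
    rwa [prod_const, card_univ, Fintype.card_fin] at this
  -- `S · M ≤ 6 ε' N`
  have hSM : S * M ≤ 6 * ε' * N := by
    rw [hSdef, hδ, hηn, hτdef]
    have p1 : ε_law * N / (M * c_an ^ t) * M = ε_law / c_an ^ t * N := by field_simp
    have p2 : η * N / (M * c_an ^ (2 * t)) * M = η / c_an ^ (2 * t) * N := by field_simp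
    have p3 : C_s * E / c_an ^ t * M ≤ C_s * D / c_an ^ t * N := by
      calc C_s * E / c_an ^ t * M ≤ C_s * E / c_an ^ t * (B * N) := by gcongr
        _ = C_s * (E * B) / c_an ^ t * N := by ring
        _ ≤ C_s * D / c_an ^ t * N := by gcongr
    have p4 : N / (M * c_an ^ t * u ^ t * ℓ) * M ≤ 1 / (c_an ^ t * ℓ) * N := by
      calc N / (M * c_an ^ t * u ^ t * ℓ) * M = 1 / (c_an ^ t * ℓ) * N * (1 / u ^ t) := by field_simp
        _ ≤ 1 / (c_an ^ t * ℓ) * N * 1 := by gcongr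
        _ = 1 / (c_an ^ t * ℓ) * N := mul_one _
    have p5 : 2 ^ (t + 1) * (C₁ * E₁ / c_an) * M ≤ 2 ^ (t + 1) * C₁ * D / c_an * N := by
      calc 2 ^ (t + 1) * (C₁ * E₁ / c_an) * M ≤ 2 ^ (t + 1) * (C₁ * E₁ / c_an) * (B * N) := by gcongr
        _ = 2 ^ (t + 1) * C₁ * (E₁ * B) / c_an * N := by ring
        _ ≤ 2 ^ (t + 1) * C₁ * D / c_an * N := by gcongr
    have p6 : 2 ^ (t + 1) * (1 / (c_an * u * ℓ)) * M ≤ 2 ^ (t + 1) * B / (4 * c_an * ℓ) * N := by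
      calc 2 ^ (t + 1) * (1 / (c_an * u * ℓ)) * M ≤ 2 ^ (t + 1) * (1 / (c_an * 4 * ℓ)) * (B * N) := by
            gcongr
        _ = 2 ^ (t + 1) * B / (4 * c_an * ℓ) * N := by ring
    have hexp : (ε_law * N / (M * c_an ^ t) + η * N / (M * c_an ^ (2 * t)) +
        (C_s * E / c_an ^ t + N / (M * c_an ^ t * u ^ t * ℓ) + ε_law * N / (M * c_an ^ t) +
          2 ^ (t + 1) * (C₁ * E₁ / c_an + 1 / (c_an * u * ℓ)))) * M =
        ε_law * N / (M * c_an ^ t) * M + η * N / (M * c_an ^ (2 * t)) * M +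
          (C_s * E / c_an ^ t * M + N / (M * c_an ^ t * u ^ t * ℓ) * M + ε_law * N / (M * c_an ^ t) * M +
            (2 ^ (t + 1) * (C₁ * E₁ / c_an) * M + 2 ^ (t + 1) * (1 / (c_an * u * ℓ)) * M)) := by ring
    rw [hexp, p1, p2]
    have hN0 := hN.le
    have hs₁ : ε_law / c_an ^ t ≤ ε' / 2 := by
      rw [le_div_iff₀ (two_pos : (0 : ℝ) < 2)]
      calc ε_law / c_an ^ t * 2 = 2 * ε_law / c_an ^ t := by ring
        _ ≤ ε' := s₁
    have q1 : ε_law / c_an ^ t * N ≤ ε' / 2 * N := mul_le_mul_of_nonneg_right hs₁ hN0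
    have q2 : η / c_an ^ (2 * t) * N ≤ ε' * N := mul_le_mul_of_nonneg_right s₂ hN0
    have q3 : C_s * E / c_an ^ t * M ≤ ε' * N := p3.trans (mul_le_mul_of_nonneg_right s₃ hN0)
    have q4 : N / (M * c_an ^ t * u ^ t * ℓ) * M ≤ ε' * N := p4.trans (mul_le_mul_of_nonneg_right s₄ hN0)
    have q5 : 2 ^ (t + 1) * (C₁ * E₁ / c_an) * M ≤ ε' * N := p5.trans (mul_le_mul_of_nonneg_right s₅ hN0)
    have q6 : 2 ^ (t + 1) * (1 / (c_an * u * ℓ)) * M ≤ ε' * N :=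
      p6.trans (mul_le_mul_of_nonneg_right s₆ hN0)
    linarith
  -- `a_1^t ≤ 2^t/ℓ^t`
  have ha1t : a 1 ^ t ≤ 2 ^ t / ℓ ^ t := by
    rw [← div_pow]; exact pow_le_pow_left₀ ha10 ha1 t
  calc |C (fun _ => 1) - M * a 1 ^ t|
      ≤ |C (fun _ => 1) - walshForm θ (fun _ => 1) * (M * a 1 ^ t)| +
          |walshForm θ (fun _ => 1) - 1| * (M * a 1 ^ t) := abs_sub_model_le _ _ _ hMm
    _ ≤ e₁ + C_W * S * (M * a 1 ^ t) := by
        refine add_le_add hlaw1 (mul_le_mul_of_nonneg_right ?_ hMm)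
        rw [hSdef]; exact hclip
    _ = e₁ + C_W * (S * M) * a 1 ^ t := by ring
    _ ≤ ε / 2 * N / ℓ ^ t + C_W * (6 * ε' * N) * (2 ^ t / ℓ ^ t) := by
        have h1 : e₁ ≤ ε / 2 * N / ℓ ^ t := by
          rw [he₁]
          exact div_le_div_of_nonneg_right (mul_le_mul_of_nonneg_right hε_law2 hN.le) (by positivity)
        have h2 : C_W * (S * M) * a 1 ^ t ≤ C_W * (6 * ε' * N) * (2 ^ t / ℓ ^ t) :=
          mul_le_mul (mul_le_mul_of_nonneg_left hSM hCW) ha1t (by positivity) (by positivity)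
        linarith
    _ = ε / 2 * N / ℓ ^ t + 6 * ε' * (C_W * 2 ^ t) * N / ℓ ^ t := by ring
    _ ≤ ε / 2 * N / ℓ ^ t + ε / 2 * N / ℓ ^ t := by gcongr
    _ = ε * N / ℓ ^ t := by ring

/-! ## Two elementary inequalities for the parameter choice -/

/-- `X e^{−Λ} ≤ m` once `Λ ≥ log (Q/m)` and `X ≤ Q` (`Q, m > 0`). [folklore] -/
theorem coeff_mul_exp_le {X Q m Λ : ℝ} (hXQ : X ≤ Q) (hQ : 0 < Q) (hm : 0 < m)
    (hΛ : Real.log (Q / m) ≤ Λ) : X * Real.exp (-Λ) ≤ m := by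
  have h1 : Real.exp (-Λ) ≤ m / Q := by
    calc Real.exp (-Λ) ≤ Real.exp (-Real.log (Q / m)) := Real.exp_le_exp.mpr (by linarith)
      _ = m / Q := by rw [Real.exp_neg, Real.exp_log (by positivity), inv_div]
  calc X * Real.exp (-Λ) ≤ Q * (m / Q) := mul_le_mul hXQ h1 (Real.exp_pos _).le hQ.le
    _ = m := by field_simp

/-- `Z/(X ℓ) ≤ Y` once `ℓ ≥ Z/(X Y)` (`ℓ > 0`). [folklore] -/
theorem div_mul_le_of_le {Z X Y ℓ : ℝ} (hX : 0 < X) (hY : 0 < Y) (hℓ0 : 0 < ℓ)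
    (hℓ : Z / (X * Y) ≤ ℓ) : Z / (X * ℓ) ≤ Y := by
  rw [div_le_iff₀ (by positivity)] at hℓ ⊢
  nlinarith

end Summit.Parity.GeneralizedHardyLittlewood.Theorems.AbsoluteUpgrade

end
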